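import Summits.RiemannHypothesis.RiemannHypothesis.Theorems.SignConeSignConeOscillatoryExtremalNonnegMollify
import Literature.NumberTheory.LFunctions.WeilExplicitContinuous
import Mathlib.Analysis.Fourier.Convolution

/-!
# Crux `SignCone.SignConeOscillatory` (stmt-RiemannHypothesis-16302), line `dual_witness` — density in energy, II:
# mollification of an `L²` window function

Second step of the density-in-energy lemma (see part I, `…DensityDilation.lean`): for `v ∈ L²` with
`supp v ⊆ [-b, b]`, the mollified `v ⋆ φₖ` (`φₖ = WeilContinuous.moll k`, the tree's normalised smooth bump of
radius `1/(k+1)`) is a Weil test supported in `[-b-1, b+1]` (indeed in `[-b - 1/(k+1), b + 1/(k+1)]`), its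
critical-line transform is `v̂ · φ̂ₖ`, and `∫ |v ⋆ φₖ - v|² → 0` — proved on the FOURIER side:
`2π ∫ |v ⋆ φₖ - v|² = ∫ |v̂(½+it)|² |φ̂ₖ(½+it) - 1|² dt → 0` by dominated convergence (`|φ̂ₖ| ≤ 1`, `φ̂ₖ → 1`,
Plancherel for `L¹ ∩ L²`).
-/

noncomputable section

-- `Summit.RiemannHypothesis.RiemannHypothesis.…` repeats a namespace component by design (D-0017 layout).
set_option linter.dupNamespace false

open scoped BigOperators ComplexConjugate Topology ENNReal FourierTransform
open MeasureTheory Set Filter Complex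

namespace Summit.RiemannHypothesis.RiemannHypothesis.Theorems.SignCone.DualWitness

open Literature.NumberTheory.LFunctions

variable {b : ℝ} {v : ℝ → ℂ}

/-! ## Window functions are `L¹`, compactly supported -/

/-! ## The mollified function is a Weil test on a slightly larger window -/

/-- `v ⋆ φₖ` is a Weil test for `v ∈ L²` supported in the window. [folklore] -/
theorem isWeilTest_weilConv_moll_of_memLp (hv : MemLp v 2 volume) (hsv : Function.support v ⊆ Icc (-b) b) (k : ℕ) :
    IsWeilTest (weilConv v (WeilContinuous.moll k)) := by
  have hi : Integrable v := integrable_of_memLp_two_of_support hv hsv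
  rw [weilConv_eq_convolution_real]
  exact ⟨(WeilContinuous.hasCompactSupport_moll k).contDiff_convolution_right (ContinuousLinearMap.mul ℝ ℂ)
      hi.locallyIntegrable (WeilContinuous.contDiff_moll k),
    HasCompactSupport.convolution (L := ContinuousLinearMap.mul ℝ ℂ)
      (HasCompactSupport.of_support_subset_isCompact isCompact_Icc hsv)
      (WeilContinuous.hasCompactSupport_moll k)⟩

/-- Support of the mollified function: `tsupport (v ⋆ φₖ) ⊆ [-b - rₖ, b + rₖ]`, `rₖ = 1/(k+1)`. [folklore] -/
theorem tsupport_weilConv_moll_subset (hsv : Function.support v ⊆ Icc (-b) b) (k : ℕ) :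
    tsupport (weilConv v (WeilContinuous.moll k)) ⊆
      Icc (-b - (WeilContinuous.bump k).rOut) (b + (WeilContinuous.bump k).rOut) := by
  refine closure_minimal ?_ isClosed_Icc
  refine (support_convolution_subset (L := ContinuousLinearMap.mul ℂ ℂ) (μ := volume)
    (f := v) (g := WeilContinuous.moll k)).trans ?_
  rintro x ⟨y, hy, z, hz, rfl⟩
  have hy' := hsv hy
  have hz' : |z| < (WeilContinuous.bump k).rOut := by
    by_contra h
    exact hz (WeilContinuous.moll_eq_zero (not_lt.1 h))
  rw [abs_lt] at hz'
  simp only [mem_Icc]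
  constructor <;> linarith [hy'.1, hy'.2, hz'.1, hz'.2]

/-- In particular `tsupport (v ⋆ φₖ) ⊆ [-c, c]` as soon as `b + 1/(k+1) ≤ c`. [folklore] -/
theorem tsupport_weilConv_moll_subset_of_le (hsv : Function.support v ⊆ Icc (-b) b) {k : ℕ} {c : ℝ}
    (hc : b + (WeilContinuous.bump k).rOut ≤ c) : tsupport (weilConv v (WeilContinuous.moll k)) ⊆ Icc (-c) c :=
  (tsupport_weilConv_moll_subset hsv k).trans (Icc_subset_Icc (by linarith) hc)

/-! ## The critical line -/

/-- **`(v ⋆ φₖ)^(½+it) = v̂(½+it) · φ̂ₖ(½+it)`** for integrable `v` (Mathlib's convolution theorem). [folklore] -/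
theorem weilMellin_weilConv_moll_half (hi : Integrable v) (k : ℕ) (t : ℝ) :
    weilMellin (weilConv v (WeilContinuous.moll k)) (1 / 2 + t * I) =
      weilMellin v (1 / 2 + t * I) * weilMellin (WeilContinuous.moll k) (1 / 2 + t * I) := by
  have hφ : Integrable (WeilContinuous.moll k) :=
    (WeilContinuous.continuous_moll k).integrable_of_hasCompactSupport (WeilContinuous.hasCompactSupport_moll k)
  rw [weilMellin_half_eq_fourier, weilMellin_half_eq_fourier, weilMellin_half_eq_fourier, weilConv,
    Real.fourier_mul_convolution_eq hi hφ]

/-- The critical-line transform of an integrable function is continuous in `t`. [folklore] -/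
theorem dens_continuous_weilMellin_half {w : ℝ → ℂ} (hi : Integrable w) :
    Continuous fun t : ℝ => weilMellin w (1 / 2 + t * I) := by
  have hFc : Continuous (𝓕 w) :=
    VectorFourier.fourierIntegral_continuous Real.continuous_fourierChar (by exact continuous_inner) hi
  have h1 : Continuous fun t : ℝ => 𝓕 w (-t / (2 * Real.pi)) :=
    hFc.comp (by fun_prop : Continuous fun t : ℝ => -t / (2 * Real.pi))
  refine h1.congr fun t => ?_
  rw [weilMellin_half_eq_fourier]

/-! ## `L²` convergence of the mollification, on the Fourier side -/

/-- `t ↦ |v̂(½+it)|²` is integrable for `v ∈ L¹ ∩ L²` (Plancherel membership). [folklore] -/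
theorem dens_integrable_norm_sq_weilMellin_half (hi : Integrable v) (h2 : MemLp v 2 volume) :
    Integrable fun t : ℝ => ‖weilMellin v (1 / 2 + t * I)‖ ^ 2 := by
  have hF2 := Literature.Analysis.FunctionSpaces.memLp_two_fourierIntegral hi h2
  have h1 : Integrable (fun ξ : ℝ => ‖𝓕 v ξ‖ ^ 2) := (memLp_two_iff_integrable_sq_norm hF2.1).mp hF2
  have h3 := h1.comp_mul_left' (R := -(1 / (2 * Real.pi))) (neg_ne_zero.mpr (by positivity))
  refine h3.congr (Eventually.of_forall fun t => ?_)
  simp only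
  rw [weilMellin_half_eq_fourier, show -(1 / (2 * Real.pi)) * t = -t / (2 * Real.pi) by ring]

/-- **`∫ |v ⋆ φₖ - v|² → 0`** for `v ∈ L²` supported in a window. [folklore] -/
theorem tendsto_integral_norm_sq_weilConv_moll_sub (hv : MemLp v 2 volume) (hsv : Function.support v ⊆ Icc (-b) b) :
    Tendsto (fun k => ∫ x, ‖weilConv v (WeilContinuous.moll k) x - v x‖ ^ 2) atTop (𝓝 0) := by
  have hi : Integrable v := integrable_of_memLp_two_of_support hv hsv
  -- the differences `hₖ = v ⋆ φₖ - v` are `L¹ ∩ L²`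
  have htest := fun k => isWeilTest_weilConv_moll_of_memLp hv hsv k
  have hgi : ∀ k, Integrable (weilConv v (WeilContinuous.moll k)) := fun k =>
    (htest k).1.continuous.integrable_of_hasCompactSupport (htest k).2
  have hg2 : ∀ k, MemLp (weilConv v (WeilContinuous.moll k)) 2 volume := fun k =>
    (htest k).1.continuous.memLp_of_hasCompactSupport (htest k).2
  have hhi : ∀ k, Integrable (weilConv v (WeilContinuous.moll k) - v) := fun k => (hgi k).sub hi
  have hh2 : ∀ k, MemLp (weilConv v (WeilContinuous.moll k) - v) 2 volume := fun k => (hg2 k).sub hv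
  -- Plancherel for `hₖ`
  have hP : ∀ k, ∫ x, ‖weilConv v (WeilContinuous.moll k) x - v x‖ ^ 2 =
      (2 * Real.pi)⁻¹ * ∫ t : ℝ, ‖weilMellin v (1 / 2 + t * I)‖ ^ 2 *
        ‖weilMellin (WeilContinuous.moll k) (1 / 2 + t * I) - 1‖ ^ 2 := by
    intro k
    have h := integral_norm_sq_weilMellin_half_of_memLp (hhi k) (hh2 k)
    have e : ∀ t : ℝ, ‖weilMellin (weilConv v (WeilContinuous.moll k) - v) (1 / 2 + t * I)‖ ^ 2 =
        ‖weilMellin v (1 / 2 + t * I)‖ ^ 2 * ‖weilMellin (WeilContinuous.moll k) (1 / 2 + t * I) - 1‖ ^ 2 := by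
      intro t
      rw [weilMellin_half_sub (hgi k) hi, weilMellin_weilConv_moll_half hi, ← mul_sub_one, norm_mul, mul_pow]
    simp_rw [e] at h
    have hpi : (0 : ℝ) < 2 * Real.pi := by positivity
    have e2 : (fun x => ‖(weilConv v (WeilContinuous.moll k) - v) x‖ ^ 2) =
        fun x => ‖weilConv v (WeilContinuous.moll k) x - v x‖ ^ 2 := by
      funext x; rfl
    rw [e2] at h
    rw [h, ← mul_assoc, inv_mul_cancel₀ hpi.ne', one_mul]
  simp_rw [hP]
  rw [show (0 : ℝ) = (2 * Real.pi)⁻¹ * 0 by ring]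
  refine Tendsto.const_mul _ ?_
  -- dominated convergence with bound `4 |v̂|²`
  have hV := dens_integrable_norm_sq_weilMellin_half hi hv
  have key : Tendsto (fun k => ∫ t : ℝ, ‖weilMellin v (1 / 2 + t * I)‖ ^ 2 *
      ‖weilMellin (WeilContinuous.moll k) (1 / 2 + t * I) - 1‖ ^ 2) atTop (𝓝 (∫ t : ℝ, (0 : ℝ))) := by
    refine tendsto_integral_of_dominated_convergence (fun t : ℝ => 4 * ‖weilMellin v (1 / 2 + t * I)‖ ^ 2)
      (fun k => ?_) (hV.const_mul 4) (fun k => Eventually.of_forall fun t => ?_) (Eventually.of_forall fun t => ?_)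
    · refine (Continuous.mul ?_ ?_).aestronglyMeasurable
      · exact ((dens_continuous_weilMellin_half hi).norm).pow 2
      · refine ((Continuous.sub ?_ continuous_const).norm).pow 2
        exact dens_continuous_weilMellin_half
          ((WeilContinuous.continuous_moll k).integrable_of_hasCompactSupport (WeilContinuous.hasCompactSupport_moll k))
    · rw [Real.norm_eq_abs, abs_of_nonneg (by positivity)]
      have h1 : ‖weilMellin (WeilContinuous.moll k) (1 / 2 + t * I) - 1‖ ≤ 2 :=
        (norm_sub_le _ _).trans (by rw [norm_one]; linarith [WeilContinuous.norm_weilMellin_moll_half_le k t])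
      have h2 : ‖weilMellin (WeilContinuous.moll k) (1 / 2 + t * I) - 1‖ ^ 2 ≤ 4 := by
        nlinarith [norm_nonneg (weilMellin (WeilContinuous.moll k) (1 / 2 + t * I) - 1)]
      nlinarith [sq_nonneg ‖weilMellin v (1 / 2 + t * I)‖]
    · have h := ((WeilContinuous.tendsto_weilMellin_moll (1 / 2 + t * I)).sub_const 1).norm
      rw [sub_self, norm_zero] at h
      have h2 := (h.pow 2).const_mul (‖weilMellin v (1 / 2 + t * I)‖ ^ 2)
      simpa using h2
  simpa using key

/-- Anchor of this file on the crux item (registered sub-goal): `L²` convergence of the mollification (`∀`-form of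
`tendsto_integral_norm_sq_weilConv_moll_sub`). [folklore] -/
theorem density_mollify_tendsto : ∀ {b : ℝ} {v : ℝ → ℂ}, MemLp v 2 volume → Function.support v ⊆ Icc (-b) b → Tendsto (fun k => ∫ x, ‖weilConv v (WeilContinuous.moll k) x - v x‖ ^ 2) atTop (𝓝 0) :=
  fun hv hsv => tendsto_integral_norm_sq_weilConv_moll_sub hv hsv

end Summit.RiemannHypothesis.RiemannHypothesis.Theorems.SignCone.DualWitness

end
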